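import Literature.AnabelianGeometry.EtaleTheta.EtaleThetaDataHalfCarrier
import Literature.AnabelianGeometry.EtaleTheta.SettingModelTateRigidityOfRecord
import Literature.AnabelianGeometry.EtaleTheta.ThetaCohomology
import HarnessLib

/-!
# [EtTh] Prop. 1.3 with REAL `½`-coefficients at the STAGE-2 (Tate shear) model `modelχq`: `Prop13` HOLDS WITH CONTENT
# for the class of record `η̈♯ = etaDdχq`; the Tate rigidity-of-record package with a contentful Prop. 1.3

S. Mochizuki, *The étale theta function and its Frobenioid-theoretic manifestations*, Publ. RIMS **45** (2009), §1,
Prop. 1.3 pp. 19–21 (printed 245–247): "`η^Θ_N` … arises from a cohomology class `∈ H¹(Π^tp_Y/Π^tp_{Z̈_N}, Δ_Θ ⊗ (½ℤ/Nℤ))`",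
"the restricted classes `O^×_{K/K̈}·η^Θ|_Ÿ` … arise naturally from classes `O^×_K̈·η̈^Θ ∈ H¹(Π^tp_Ÿ, Δ_Θ)` … 'without
denominators'" [cite: MochizukiEtTh2009, Prop 1.3 p.20]. Layer L2 of the abc-iut cell, seat abc-iut-L2-t1 (gen 12;
abc-iut-L2-lead R1194 (A) «HALF-CARRIER@modelχq»). PROOF-ONLY companion (no `def`, no instance, no `Prop` fact) of this seat's
`EtaleThetaDataHalfCarrier.lean` (the constructor `KummerData.etaleThetaDataHalf E₀ η̈ e` with REAL `½`-groups:
`H¹(−, ½Δ_Θ) := H¹(−, Δ_Θ)` with `ofIntegral := x ↦ x²`, levels `Δ_Θ/(2N)·Δ_Θ`, real restrictions), over abc-iut-L2-t6's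
stage-2 `z`-class (`SettingModelTateZClass`: `zClassYχq`, `zClassYddχq`, `etaDdχq := infl zClassYddχq`, `zPartχq`,
`mul_refReprχq_inv_eq_inl`), abc-iut-L6-d6's `cThetaχq` / `toThetaq_eq_of_right_eq_one` and abc-iut-L2-t8's capstone
`SettingModelTateRigidityOfRecord` — all consumed BY NAME.

RESULTS (stage 2, every `p i j`, `j` even; the `Y`-class "`2·η^Θ`" is `e♯ := (infl zClassYχq)²`, which DESCENDS to `Y`):
* `toTheta_inl_mem_lDeltaTheta_of_hHat_eq_one` — the coordinate lemma: an element `inl γ` of `Ker(Π^tp_X ↠ (Π^tp_X)^ell)` whose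
  level-`N` Heisenberg image is trivial maps into `N·Δ_Θ` (its `Ẑ`-coordinate on the theta centre is `≡ 0 (mod N)`);
* `zPartχq_toTheta_mem_lDeltaTheta` — for `g ∈ Π^tp_Y` with `ĥ_N(g) = 1` the `z`-part of `θ(g)` lies in `N·Δ_Θ`; hence on
  `Π^tp_{Z̈_N}` the SQUARE of the `z`-cocycle is `(2N)·Δ_Θ`-valued and `reduceMod_res_inflTheta_zClassYχq_sq` — print's clause
  "`η^Θ_N` arises from a class `∈ H¹(Π^tp_Y/Π^tp_{Z̈_N}, Δ_Θ ⊗ ½ℤ/Nℤ)`" COMPUTED at stage 2;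
* `res_inflTheta_zClassYχq` — `(infl zClassYχq)|_Ÿ = etaDdχq` (the class of record descends to `Y`);
* **`prop13_half_modelχq`** — `Prop13` HOLDS WITH CONTENT at `E₀.etaleThetaDataHalf etaDdχq e♯` for EVERY Kummer datum `E₀` of
  `modelχq p i j` (no hypothesis); `not_rmk131_half_modelχq` — Rmk. 1.3.1 FAILS there (`e♯` is a square over `Y`: the model's
  class descends — print's p. 247 reason read backwards, as at stage 1);
* generic transfer (`Iff.rfl`-level, any `ThetaSetting`): `prop15iii_half_iff_ofClass`, `prop14iiiKummer_half_iff_ofClass`,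
  `prop14iiiValues_half_iff_ofClass` — Props. 1.4 (iii) / 1.5 (iii) read only `toKummerData` and `η̈`, so they do not see the
  `½`-groups;
* **`prop13_half_prop15_sectionData_modelTate`** — at the Tate instance `modelχq p 1 2`, for EVERY continuous Galois section `s`:
  Prop. 1.3 (WITH CONTENT, real `½`-carrier) ∧ Prop. 1.5 (i) ∧ (ii) ∧ (iii) at ONE étale-theta datum carrying `η̈♯` — the
  rigidity-of-record package of abc-iut-L2-t8 (`prop13_prop15_sectionData_modelTate`) with its degenerate Prop. 1.3 conjunct
  upgraded.
HONEST FRAMING: statements about the SEMI-SYNTHETIC stage-2 model (consistency / non-vacuity evidence for the typed §1 interface;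
not the tempered `π₁` of a curve, no theta FUNCTION); nothing of [EtTh] is asserted; no side is taken on [IUTchIII] Cor. 3.12;
typed ≠ proved.
-/

noncomputable section

namespace Literature.AnabelianGeometry.EtaleTheta

open scoped IsMulCommutative

/-! ### Generic: Props. 1.4 (iii) / 1.5 (iii) do not see the `½`-groups -/

namespace ThetaSetting.KummerData

variable {p : ℕ} [Fact p.Prime] {D : ThetaSetting p} (E₀ : D.KummerData) (η : D.H1 D.GtpYdd) (e : D.H1 D.GtpY)

/-- **Prop. 1.5 (iii) at the half-carrier datum ⟺ at the datum of class `η̈`** (both have `toKummerData = E₀`, `etaDd = η̈`;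
`Prop15iii` reads nothing else). [cite: MochizukiEtTh2009, Prop 1.5 (iii) p.23] -/
theorem prop15iii_half_iff_ofClass (hC : D.Compat) :
    Prop15iii (E₀.etaleThetaDataHalf η e) hC ↔ Prop15iii (E₀.etaleThetaDataOfClass η) hC :=
  Iff.rfl

/-- **Prop. 1.4 (iii), Kummer clause, at the half-carrier datum ⟺ at the datum of class `η̈`.**
[cite: MochizukiEtTh2009, Prop 1.4 (iii) p.22] -/
theorem prop14iiiKummer_half_iff_ofClass (k : D.H1 D.GtpYdd) :
    Prop14iiiKummer (E₀.etaleThetaDataHalf η e) k ↔ Prop14iiiKummer (E₀.etaleThetaDataOfClass η) k :=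
  Iff.rfl

/-- **Prop. 1.4 (iii), values clause, at the half-carrier datum ⟺ at the datum of class `η̈`.**
[cite: MochizukiEtTh2009, Prop 1.4 (iii) p.22] -/
theorem prop14iiiValues_half_iff_ofClass :
    Prop14iiiValues (E₀.etaleThetaDataHalf η e) ↔ Prop14iiiValues (E₀.etaleThetaDataOfClass η) :=
  Iff.rfl

end ThetaSetting.KummerData

namespace SettingModel

open Literature.AnabelianGeometry.SemiGraphs

variable (p : ℕ) [Fact p.Prime] (i j : ℤ)

/-! ### The coordinate lemma: trivial level-`N` Heisenberg image ⇒ the theta-centre coordinate is `≡ 0 (mod N)` -/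

/-- **An element `inl γ ∈ Ker(Π^tp_X ↠ (Π^tp_X)^ell)` with `ĥ_N(γ) = 1` maps into `N·Δ_Θ`** (stage 2): its image in
`(Π^tp_X)^Θ` is `c^t` with `t ≡ 0 (mod N)` (the `z`-coordinate of `ĥ_N(γ)` is `t mod N`), and `t = s^N` in `Ẑ`.
[cite: MochizukiEtTh2009, Prop 1.3 p.20] -/
theorem toTheta_inl_mem_lDeltaTheta_of_hHat_eq_one (hj : Even j) (N : ℕ+) (γ : Gfp)
    (hγ : (SemidirectProduct.inl γ : PiTpχq p i j) ∈ CurveTheta.ellKer (curveχq p i j))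
    (hN : hHat N (gfpFst γ) = 1) :
    CurveTheta.toTheta (curveχq p i j) (SemidirectProduct.inl γ) ∈ (ThetaSetting.modelχq p i j hj).lDeltaTheta N := by
  obtain ⟨hxy, -⟩ := (mem_ellKerχq_iff p i j _).mp hγ
  rw [SemidirectProduct.left_inl] at hxy
  have hcl : gfpFst γ ∈ (⁅(⊤ : Subgroup F₂hatT), (⊤ : Subgroup F₂hatT)⁆).topologicalClosure :=
    (mem_closure_commutator₂_iff_forall_hHat _).mpr hxy
  obtain ⟨t, ht, htN⟩ := exists_mul_inv_cPow_mem_closure₃ _ powHat_commutator_spec hcl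
  -- the image of `inl γ` in `(Π^tp_X)^Θ` is `c^t`
  have hct : CurveTheta.toTheta (curveχq p i j) (SemidirectProduct.inl γ) = cThetaχq p i j t := by
    rw [cThetaχq_apply]
    exact toThetaq_eq_of_right_eq_one p i j _ _ (SemidirectProduct.right_inl _) (SemidirectProduct.right_inl _)
      (by simpa using ht)
  -- `t ≡ 0 (mod N)`
  have hlev : ZHatLevel.level N t = 1 := by
    have hz := congrArg Heis.z (htN N)
    rw [hN] at hz
    simp only [Heis.one_z] at hz
    rw [← modN_eq_level, ← ofAdd_toAdd (modN N t), ← hz, ofAdd_zero]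
  obtain ⟨s, hs⟩ := (ZHatLevel.level_eq_one_iff_exists_pow N t).mp hlev
  refine ⟨cThetaχq p i j s, cThetaχq_mem_ker p i j s, ?_⟩
  rw [← map_pow, hs, ← hct]

/-- **The `z`-part of `θ(g)` lies in `N·Δ_Θ` for `g ∈ Π^tp_Y` with trivial level-`N` Heisenberg image** (stage 2): the
representative `inl(g.left · b^{−ŷ(g)})` of the `z`-part (`mul_refReprχq_inv_eq_inl`) has `ĥ_N = ĥ_N(g.left) · ĥ_N(b^{ŷ(g)})⁻¹ = 1`
(`ŷ(g) ≡ 0 (mod N)` because the `y`-coordinate of `ĥ_N(g.left)` vanishes). [cite: MochizukiEtTh2009, Prop 1.3 p.20] -/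
theorem zPartχq_toTheta_mem_lDeltaTheta (hj : Even j) (N : ℕ+) {g : PiTpχq p i j}
    (hg : g ∈ (ThetaSetting.modelχq p i j hj).GtpY) (hN : levelHom N g.left = 1) :
    zPartχq p i j (CurveTheta.toTheta (curveχq p i j) g) ∈ (ThetaSetting.modelχq p i j hj).lDeltaTheta N := by
  have hΔ : zPartχq p i j (CurveTheta.toTheta (curveχq p i j) g) ∈ (ThetaSetting.modelχq p i j hj).DeltaTheta :=
    zPartχq_mem_deltaTheta p i j hj ⟨g, hg, rfl⟩
  have hz : zPartχq p i j (CurveTheta.toTheta (curveχq p i j) g) =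
      CurveTheta.toTheta (curveχq p i j) (SemidirectProduct.inl (g.left * (bPowGfp (yCoordχq p i j g))⁻¹)) := by
    rw [zPartχq_def, refLiftχq_def, ← map_inv, ← map_mul, mul_refReprχq_inv_eq_inl]
  rw [hz] at hΔ ⊢
  refine toTheta_inl_mem_lDeltaTheta_of_hHat_eq_one p i j hj N _
    ((CurveTheta.mk_mem_ker_thetaToEll_iff (curveχq p i j) _).mp hΔ) ?_
  -- `ĥ_N(g.left · b^{−ŷ(g)}) = 1`
  have hy : ZHatLevel.level N (yCoordχq p i j g) = 1 := by
    have h0 : (hHat N (gfpFst g.left)).y = 0 := by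
      change (levelHom N g.left).y = 0
      rw [hN, Heis.one_y]
    rw [← modN_eq_level, yCoordχq_apply]
    exact (hHat_y_eq_zero_iff N _).mp h0
  change levelHom N (g.left * (bPowGfp (yCoordχq p i j g))⁻¹) = 1
  rw [map_mul, map_inv, hN, levelHom_bPowGfp, hy, toAdd_one, one_mul, inv_eq_one]
  rfl

/-- **On `Π^tp_{Z̈_N}` the SQUARE of the `z`-part is `(2N)·Δ_Θ`-valued** (stage 2; the `z`-part itself is `N·Δ_Θ`-valued there:
`Π^tp_{Z̈_N} ≤ Π^tp_{Z_N}` has trivial level-`N` Heisenberg image). [cite: MochizukiEtTh2009, Prop 1.3 p.20] -/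
theorem zPartχq_sq_mem_lDeltaTheta_of_mem_GtpZddN (hj : Even j) (N : ℕ+) {g : PiTpχq p i j}
    (hg : g ∈ (ThetaSetting.modelχq p i j hj).GtpZddN N) :
    zPartχq p i j (CurveTheta.toTheta (curveχq p i j) g) * zPartχq p i j (CurveTheta.toTheta (curveχq p i j) g) ∈
      (ThetaSetting.modelχq p i j hj).lDeltaTheta (2 * (N : ℕ)) := by
  have hZ : g ∈ (ThetaSetting.modelχq p i j hj).GtpZN N := (Subgroup.mem_inf.mp hg).2
  obtain ⟨hl, -⟩ := (GfpTwistData₀.mem_ZN (tateTwistData₀ p i j)).mp hZ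
  have hN : levelHom N g.left = 1 := (Subgroup.mem_inf.mp hl).2
  have hY : g ∈ (ThetaSetting.modelχq p i j hj).GtpY := (ThetaSetting.modelχq p i j hj).GtpZddN_le_GtpY N hg
  obtain ⟨y, hy, hyN⟩ := zPartχq_toTheta_mem_lDeltaTheta p i j hj N hY hN
  refine ⟨y, hy, ?_⟩
  rw [← hyN, two_mul, pow_add]

/-! ### The class of record descends to `Y`; the `Z̈_N`-clause computed -/

/-- **`(infl zClassYχq)|_Ÿ = η̈♯`**: the stage-2 class of record `etaDdχq = infl zClassYddχq` is the restriction of the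
`Y`-class `infl zClassYχq ∈ H¹(Π^tp_Y, Δ_Θ)` — it DESCENDS to `Y`. [cite: MochizukiEtTh2009, Prop 1.3 p.21] -/
theorem res_inflTheta_zClassYχq (hj : Even j) :
    ContH1.res (ThetaSetting.modelχq p i j hj).toTheta (ThetaSetting.modelχq p i j hj).DeltaTheta
        (ThetaSetting.modelχq p i j hj).GtpYdd_le_GtpY
        ((ThetaSetting.modelχq p i j hj).inflTheta (ThetaSetting.modelχq p i j hj).GtpY (zClassYχq p i j hj)) =
      etaDdχq p i j hj := by
  rw [ThetaSetting.KummerData.res_inflTheta_GtpY, res_zClassYχq, etaDdχq_def]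

/-- **The `Z̈_N`-clause of Prop. 1.3, COMPUTED at stage 2**: the class `(infl zClassYχq)²` ("`2·η^Θ`"), restricted to `Π^tp_{Z̈_N}`
and reduced modulo `(2N)·Δ_Θ` (= coefficients `Δ_Θ ⊗ ½ℤ/Nℤ`), is trivial — print's "`η^Θ_N` arises from a class
`∈ H¹(Π^tp_Y/Π^tp_{Z̈_N}, Δ_Θ ⊗ ½ℤ/Nℤ)`" (p. 20). [cite: MochizukiEtTh2009, Prop 1.3 p.20] -/
theorem reduceMod_res_inflTheta_zClassYχq_sq (hj : Even j) (N : ℕ+) :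
    (ThetaSetting.modelχq p i j hj).reduceMod (2 * N) ((ThetaSetting.modelχq p i j hj).GtpZddN N)
      (ContH1.res (ThetaSetting.modelχq p i j hj).toTheta (ThetaSetting.modelχq p i j hj).DeltaTheta
        ((ThetaSetting.modelχq p i j hj).GtpZddN_le_GtpY N)
        ((ThetaSetting.modelχq p i j hj).inflTheta (ThetaSetting.modelχq p i j hj).GtpY (zClassYχq p i j hj) ^ 2)) = 1 := by
  haveI := (ThetaSetting.modelχq p i j hj).lDeltaTheta_normal (2 * (N : ℕ))
  rw [map_pow]
  change (ThetaSetting.modelχq p i j hj).reduceMod (2 * N) ((ThetaSetting.modelχq p i j hj).GtpZddN N)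
      (ContH1.mk (fun g : ↥((ThetaSetting.modelχq p i j hj).GtpZddN N) =>
        zFunχq p i j hj _ le_rfl ⟨(ThetaSetting.modelχq p i j hj).toTheta (g : PiTpχq p i j),
          ⟨(g : PiTpχq p i j), (ThetaSetting.modelχq p i j hj).GtpZddN_le_GtpY N g.2, rfl⟩⟩) _ ^ 2) = 1
  rw [pow_two, ContH1.mk_mul_mk]
  exact ContH1.reduce_mk_eq_one_of_forall_mem (ThetaSetting.modelχq p i j hj).toTheta
    (ThetaSetting.modelχq p i j hj).DeltaTheta ((ThetaSetting.modelχq p i j hj).lDeltaTheta (2 * (N : ℕ)))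
    ((ThetaSetting.modelχq p i j hj).GtpZddN N) _ _ fun g =>
    zPartχq_sq_mem_lDeltaTheta_of_mem_GtpZddN p i j hj N g.2

/-! ### Prop. 1.3 WITH CONTENT at stage 2; Rmk. 1.3.1 fails for the untwisted datum -/

variable (hj : Even j) (E₀ : (ThetaSetting.modelχq p i j hj).KummerData)

/-- **Prop. 1.3 HOLDS, WITH CONTENT, at the stage-2 model** for the half-carrier datum of the class of record: `η̈ := etaDdχq`,
`e♯ := (infl zClassYχq)²` ("`2·η^Θ`") over ANY Kummer datum `E₀` of `modelχq p i j` — `eta_res_Ydd`: `e♯|_Ÿ = etaDdχq²`;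
`resZN_etaN`: `reduceMod_res_inflTheta_zClassYχq_sq`; the two `toLevel` clauses definitional (as in print).
[cite: MochizukiEtTh2009, Prop 1.3 p.20] -/
theorem prop13_half_modelχq :
    ThetaSetting.Prop13 (E₀.etaleThetaDataHalf (etaDdχq p i j hj)
      ((ThetaSetting.modelχq p i j hj).inflTheta (ThetaSetting.modelχq p i j hj).GtpY (zClassYχq p i j hj) ^ 2)) := by
  refine (E₀.prop13_half_iff _ _).mpr ⟨⟨etaDdχq p i j hj, E₀.mem_thetaClasses_etaleThetaDataHalf _ _, ?_⟩, fun N => ?_⟩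
  · rw [map_pow, res_inflTheta_zClassYχq]
  · rw [ContH1.res_reduce]
    exact reduceMod_res_inflTheta_zClassYχq_sq p i j hj N

/-- **Rmk. 1.3.1 FAILS at the stage-2 model** for that datum: `e♯` IS a square over `Y` (the class of record descends to `Y`).
[cite: MochizukiEtTh2009, Rmk 1.3.1 p.21] -/
theorem not_rmk131_half_modelχq :
    ¬ ThetaSetting.Rmk131 (E₀.etaleThetaDataHalf (etaDdχq p i j hj)
      ((ThetaSetting.modelχq p i j hj).inflTheta (ThetaSetting.modelχq p i j hj).GtpY (zClassYχq p i j hj) ^ 2)) :=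
  E₀.not_rmk131_half_of_eq_sq _ _ _ rfl

/-- **Census ∃-form at stage 2**: an étale-theta datum over ANY Kummer datum `E₀` of `modelχq p i j`, carrying the class of record
`η̈♯`, with REAL `½`-groups, at which Prop. 1.3 holds with content (and Rmk. 1.3.1 fails). [cite: MochizukiEtTh2009, Prop 1.3 p.20] -/
theorem exists_half_prop13_modelχq :
    ∃ E : (ThetaSetting.modelχq p i j hj).EtaleThetaData, E.toKummerData = E₀ ∧ E.etaDd = etaDdχq p i j hj ∧
      ThetaSetting.Prop13 E ∧ ¬ ThetaSetting.Rmk131 E :=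
  ⟨_, rfl, rfl, prop13_half_modelχq p i j hj E₀, not_rmk131_half_modelχq p i j hj E₀⟩

/-! ### The Tate instance: the rigidity data of record with a CONTENTFUL Prop. 1.3 -/

/-- **Prop. 1.3 (WITH CONTENT, real `½`-carrier) ∧ Prop. 1.5 (i) ∧ (ii) ∧ (iii) at ONE étale-theta datum of the Tate instance**
`modelχq p 1 2` — the section datum of ANY continuous Galois section `s` carrying the class of record `η̈♯` and the `Y`-class
`e♯ = (infl zClassYχq)²`: abc-iut-L2-t8's `prop13_prop15_sectionData_modelTate` with its Prop. 1.3 conjunct moved from the degenerate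
`½`-data to the half-carrier (Props. 1.5 (i)/(ii) are about the Kummer datum; (iii) transfers by `prop15iii_half_iff_ofClass`).
[cite: MochizukiEtTh2009, Prop 1.5 (iii) p.23] -/
theorem prop13_half_prop15_sectionData_modelTate (hC : (ThetaSetting.modelχq p 1 2 even_two).Compat)
    (s : GQp p →* (ThetaSetting.modelχq p 1 2 even_two).PiTemp) (hs : Continuous s)
    (hsec : ∀ σ : GQp p, (ThetaSetting.modelχq p 1 2 even_two).aug (s σ) = σ)
    (hsY : (ThetaSetting.modelχq p 1 2 even_two).GK.map s ≤ (ThetaSetting.modelχq p 1 2 even_two).GtpY)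
    (hsYdd : (ThetaSetting.modelχq p 1 2 even_two).GKdd.map s ≤ (ThetaSetting.modelχq p 1 2 even_two).GtpYdd) :
    ThetaSetting.Prop13 (((kummerCoreχq p 1 2 even_two).toKummerDataOfSection s hs hsec hsY hsYdd).etaleThetaDataHalf
        (etaDdχq p 1 2 even_two)
        ((ThetaSetting.modelχq p 1 2 even_two).inflTheta (ThetaSetting.modelχq p 1 2 even_two).GtpY
          (zClassYχq p 1 2 even_two) ^ 2)) ∧
      ThetaSetting.Prop15i ((kummerCoreχq p 1 2 even_two).toKummerDataOfSection s hs hsec hsY hsYdd) hC ∧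
      ThetaSetting.Prop15ii ((kummerCoreχq p 1 2 even_two).toKummerDataOfSection s hs hsec hsY hsYdd) hC ∧
      ThetaSetting.Prop15iii (((kummerCoreχq p 1 2 even_two).toKummerDataOfSection s hs hsec hsY hsYdd).etaleThetaDataHalf
        (etaDdχq p 1 2 even_two)
        ((ThetaSetting.modelχq p 1 2 even_two).inflTheta (ThetaSetting.modelχq p 1 2 even_two).GtpY
          (zClassYχq p 1 2 even_two) ^ 2)) hC := by
  obtain ⟨-, h15i, h15ii, h15iii⟩ := prop13_prop15_sectionData_modelTate p s hs hsec hsY hsYdd hC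
  exact ⟨prop13_half_modelχq p 1 2 even_two _, h15i, h15ii,
    (ThetaSetting.KummerData.prop15iii_half_iff_ofClass _ _ _ hC).mpr h15iii⟩

end SettingModel

end Literature.AnabelianGeometry.EtaleTheta

end
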